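import Literature.Analysis.Complex.JensenCarlemanFormula
import HarnessLib

/-!
# One-sided bound for `−Re f'/f` by nearby zeros (Heath-Brown's use of Lemma 3.2)

Topic `Literature/Analysis/Complex`. Everything in this file is PROVED (no named fact).

From the Jensen–Carleman formula (`Literature.Analysis.Complex.re_logDeriv_eq_sum_add_integral`,
Heath-Brown 1992, Lemma 3.2) one reads off the inequality by which Heath-Brown proves his Lemma 3.1
(Proc. London Math. Soc. (3) 64 (1992), pp. 277–279): if `f` is holomorphic on `|z − c| ≤ R`,
`f(c) ≠ 0`, `f ≠ 0` on `|z − c| = R`, all zeros `u` of `f` in the disc lie to the left of the centre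
(`Re u ≤ Re c`), and on the circle

* `|log‖f(c + Re^{iθ})‖| ≤ M` where `cos θ ≥ 0` (the right half), and
* `log‖f(c + Re^{iθ})‖ ≤ M'` where `cos θ ≤ 0` (the left half),

then for EVERY sub-collection `T` of the zeros

  `−Re f'(c)/f(c) ≤ −∑_{u ∈ T} n(u) Re(1/(c − u) + (u − c)/R²) + 2(M + M')/(πR)`

(`neg_re_logDeriv_le_of_bounds`): the discarded zero terms are `≥ 0`
(`JensenCarleman.re_inv_sub_add_div_sq_nonneg`), and `−∫ cos θ log‖f‖ ≤ M ∫ cos⁺ + M' ∫ cos⁻ = 2M + 2M'`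
(`integral_abs_cos_eq_four`). Heath-Brown sharpens the left-half contribution by using a bound
`log|L| ≤ φ(1−σ)L` linear in `σ` (whence his `φ/2`); the cruder form above, with the trivial bound
for `L(s, χ)`, is what the tree's Deuring–Heilbronn argument uses.

## References

* D. R. Heath-Brown, Proc. London Math. Soc. (3) 64 (1992), Lemma 3.1, Lemma 3.2, (3.5)–(3.7).
  [cite: HeathBrown1992PLMS, Lemma 3.1 (proof)]
-/

noncomputable section

open Complex MeasureTheory Set Metric Filter Topology Real intervalIntegral

namespace Literature.Analysis.Complex

namespace JensenCarleman

/-! ### `∫₀^{2π} |cos θ| dθ = 4` and the half-circle integrals -/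

/-- `∫_{-π/2}^{π/2} |cos θ| dθ = 2`. [folklore] -/
theorem integral_abs_cos_neg_pi_div_two_pi_div_two :
    ∫ θ in (-(π / 2))..(π / 2), |Real.cos θ| = 2 := by
  have h : ∫ θ in (-(π / 2))..(π / 2), |Real.cos θ| = ∫ θ in (-(π / 2))..(π / 2), Real.cos θ := by
    refine intervalIntegral.integral_congr fun θ hθ => ?_
    rw [uIcc_of_le (by linarith [Real.pi_pos])] at hθ
    exact abs_of_nonneg (Real.cos_nonneg_of_mem_Icc hθ)
  rw [h, integral_cos, Real.sin_pi_div_two, Real.sin_neg, Real.sin_pi_div_two]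
  norm_num

/-- `∫_{π/2}^{3π/2} |cos θ| dθ = 2`. [folklore] -/
theorem integral_abs_cos_pi_div_two_three_pi_div_two :
    ∫ θ in (π / 2)..(π / 2 + π), |Real.cos θ| = 2 := by
  have h : ∫ θ in (π / 2)..(π / 2 + π), |Real.cos θ| = ∫ θ in (π / 2)..(π / 2 + π), -Real.cos θ := by
    refine intervalIntegral.integral_congr fun θ hθ => ?_
    rw [uIcc_of_le (by linarith [Real.pi_pos])] at hθ
    exact abs_of_nonpos (Real.cos_nonpos_of_pi_div_two_le_of_le hθ.1 (by linarith [hθ.2]))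
  rw [h, intervalIntegral.integral_neg, integral_cos, Real.sin_add_pi, Real.sin_pi_div_two]
  norm_num

/-- **`∫₀^{2π} |cos θ| dθ = 4`.** [folklore] -/
theorem integral_abs_cos_eq_four : ∫ θ in (0 : ℝ)..2 * π, |Real.cos θ| = 4 := by
  have hper : Function.Periodic (fun θ : ℝ => |Real.cos θ|) (2 * π) := fun θ => by
    simp [Real.cos_add_two_pi]
  have h1 : ∫ θ in (0 : ℝ)..2 * π, |Real.cos θ| = ∫ θ in (-(π / 2))..(-(π / 2) + 2 * π), |Real.cos θ| := by
    have := hper.intervalIntegral_add_eq 0 (-(π / 2))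
    rwa [zero_add] at this
  have hint : ∀ a b : ℝ, IntervalIntegrable (fun θ : ℝ => |Real.cos θ|) volume a b := fun a b =>
    (Real.continuous_cos.abs).intervalIntegrable a b
  rw [h1, ← intervalIntegral.integral_add_adjacent_intervals (hint (-(π / 2)) (π / 2))
    (hint (π / 2) (-(π / 2) + 2 * π)), integral_abs_cos_neg_pi_div_two_pi_div_two,
    show -(π / 2) + 2 * π = π / 2 + π by ring, integral_abs_cos_pi_div_two_three_pi_div_two]
  norm_num

/-- `∫₀^{2π} max(cos θ, 0) dθ = 2`. [folklore] -/
theorem integral_max_cos_zero : ∫ θ in (0 : ℝ)..2 * π, max (Real.cos θ) 0 = 2 := by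
  have h : (fun θ : ℝ => max (Real.cos θ) 0) = fun θ => (1 / 2 : ℝ) * Real.cos θ + (1 / 2 : ℝ) * |Real.cos θ| := by
    funext θ
    rcases le_or_gt 0 (Real.cos θ) with hc | hc
    · rw [max_eq_left hc, abs_of_nonneg hc]; ring
    · rw [max_eq_right hc.le, abs_of_neg hc]; ring
  rw [h, intervalIntegral.integral_add, intervalIntegral.integral_const_mul,
    intervalIntegral.integral_const_mul, integral_cos, integral_abs_cos_eq_four, Real.sin_two_pi,
    Real.sin_zero]
  · norm_num
  · exact (continuous_const.mul Real.continuous_cos).intervalIntegrable _ _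
  · exact (continuous_const.mul Real.continuous_cos.abs).intervalIntegrable _ _

/-- `∫₀^{2π} max(−cos θ, 0) dθ = 2`. [folklore] -/
theorem integral_max_neg_cos_zero : ∫ θ in (0 : ℝ)..2 * π, max (-Real.cos θ) 0 = 2 := by
  have h : (fun θ : ℝ => max (-Real.cos θ) 0) = fun θ => (1 / 2 : ℝ) * |Real.cos θ| - (1 / 2 : ℝ) * Real.cos θ := by
    funext θ
    rcases le_or_gt 0 (Real.cos θ) with hc | hc
    · rw [max_eq_right (by linarith), abs_of_nonneg hc]; ring
    · rw [max_eq_left (by linarith), abs_of_neg hc]; ring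
  rw [h, intervalIntegral.integral_sub, intervalIntegral.integral_const_mul,
    intervalIntegral.integral_const_mul, integral_cos, integral_abs_cos_eq_four, Real.sin_two_pi,
    Real.sin_zero]
  · norm_num
  · exact (continuous_const.mul Real.continuous_cos.abs).intervalIntegrable _ _
  · exact (continuous_const.mul Real.continuous_cos).intervalIntegrable _ _

end JensenCarleman

open JensenCarleman

/-- **One-sided bound for `−Re f'/f` by the nearby zeros (Heath-Brown 1992, proof of Lemma 3.1).**
Let `f` be holomorphic on a neighbourhood of `|z − c| ≤ R` (`R > 0`), `f(c) ≠ 0`, `f ≠ 0` on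
`|z − c| = R`, and suppose every zero of `f` in the disc has real part `≤ Re c`. Suppose that on the
circle `z = c + Re^{iθ}` one has `|log‖f(z)‖| ≤ M` where `cos θ ≥ 0` and `log‖f(z)‖ ≤ M'` where
`cos θ ≤ 0`. Then for every sub-collection `T` of the zeros of `f` in the disc (multiplicities `n(u)`
from Mathlib's divisor),

  `−Re f'(c)/f(c) ≤ −∑_{u ∈ T} n(u) Re(1/(c − u) + (u − c)/R²) + 2(M + M')/(πR)`.

(Heath-Brown: "`−Re L'/L(s₀, χ) ≤ −∑_{|s₀−ρ|≤R} Re(1/(s₀−ρ) − (s₀−ρ)/R²) + L{…}`. We may discard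
zeros … since `Re(1/(s₀−ρ) − (s₀−ρ)/R²) = (σ₀−β)(|s₀−ρ|⁻² − R⁻²) ≥ 0`".)
[cite: HeathBrown1992PLMS, Lemma 3.1 (proof, (3.5)–(3.7))] -/
theorem neg_re_logDeriv_le_of_bounds {f : ℂ → ℂ} {c : ℂ} {R M M' : ℝ} (hR : 0 < R)
    (hf : AnalyticOnNhd ℂ f (closedBall c R)) (hc : f c ≠ 0)
    (hsph : ∀ z ∈ sphere c R, f z ≠ 0)
    (hleft : ∀ u ∈ ((MeromorphicOn.divisor f (closedBall c R)).finiteSupport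
        (isCompact_closedBall c R)).toFinset, u.re ≤ c.re)
    (hM : ∀ θ : ℝ, 0 ≤ Real.cos θ → |Real.log ‖f (circleMap c R θ)‖| ≤ M)
    (hM' : ∀ θ : ℝ, Real.cos θ ≤ 0 → Real.log ‖f (circleMap c R θ)‖ ≤ M')
    {T : Finset ℂ}
    (hT : T ⊆ ((MeromorphicOn.divisor f (closedBall c R)).finiteSupport (isCompact_closedBall c R)).toFinset) :
    -(deriv f c / f c).re ≤
      -(∑ u ∈ T, ((MeromorphicOn.divisor f (closedBall c R) u).toNat : ℝ) *
          (1 / (c - u) + (u - c) / (R : ℂ) ^ 2).re) + 2 * (M + M') / (π * R) := by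
  classical
  set D := MeromorphicOn.divisor f (closedBall c R) with hD
  set S := (D.finiteSupport (isCompact_closedBall c R)).toFinset with hS
  rw [re_logDeriv_eq_sum_add_integral hR hf hc hsph]
  -- (1) drop the zeros outside `T`
  have hterm : ∀ u ∈ S, 0 ≤ ((D u).toNat : ℝ) * (1 / (c - u) + (u - c) / (R : ℂ) ^ 2).re := by
    intro u hu
    refine mul_nonneg (Nat.cast_nonneg _) (re_inv_sub_add_div_sq_nonneg ?_ (hleft u hu))
    have hin : u ∈ closedBall c R := by
      rw [hS, Set.Finite.mem_toFinset] at hu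
      exact D.supportWithinDomain hu
    simpa [dist_eq_norm] using hin
  have hsum : ∑ u ∈ T, ((D u).toNat : ℝ) * (1 / (c - u) + (u - c) / (R : ℂ) ^ 2).re ≤
      ∑ u ∈ S, ((D u).toNat : ℝ) * (1 / (c - u) + (u - c) / (R : ℂ) ^ 2).re :=
    Finset.sum_le_sum_of_subset_of_nonneg hT fun u hu _ => hterm u hu
  -- (2) bound the integral
  have hπR : 0 < π * R := mul_pos Real.pi_pos hR
  have hcont : Continuous fun θ : ℝ => Real.log ‖f (circleMap c R θ)‖ := by
    have h1 : Continuous fun θ : ℝ => f (circleMap c R θ) :=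
      hf.continuousOn.comp_continuous (continuous_circleMap c R)
        fun θ => circleMap_mem_closedBall c hR.le θ
    refine (continuous_norm.comp h1).log fun θ => norm_ne_zero_iff.2 (hsph _ ?_)
    exact circleMap_mem_sphere c hR.le θ
  have hpt : ∀ θ : ℝ, -(Real.cos θ * Real.log ‖f (circleMap c R θ)‖) ≤
      M * max (Real.cos θ) 0 + M' * max (-Real.cos θ) 0 := by
    intro θ
    rcases le_total 0 (Real.cos θ) with h0 | h0
    · rw [max_eq_left h0, max_eq_right (by linarith)]
      have h1 := hM θ h0
      have h2 : -Real.log ‖f (circleMap c R θ)‖ ≤ M := by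
        have := neg_abs_le (Real.log ‖f (circleMap c R θ)‖); linarith
      nlinarith
    · rw [max_eq_right h0, max_eq_left (by linarith)]
      have h1 := hM' θ h0
      nlinarith
  have hineq : -(∫ θ in (0 : ℝ)..2 * π, Real.cos θ * Real.log ‖f (circleMap c R θ)‖) ≤ 2 * M + 2 * M' := by
    rw [← intervalIntegral.integral_neg]
    have hi1 : IntervalIntegrable (fun θ : ℝ => -(Real.cos θ * Real.log ‖f (circleMap c R θ)‖))
        volume 0 (2 * π) := ((Real.continuous_cos.mul hcont).neg).intervalIntegrable _ _
    have hi2 : IntervalIntegrable (fun θ : ℝ => M * max (Real.cos θ) 0 + M' * max (-Real.cos θ) 0)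
        volume 0 (2 * π) := by
      refine Continuous.intervalIntegrable ?_ _ _
      exact (continuous_const.mul (Real.continuous_cos.max continuous_const)).add
        (continuous_const.mul (Real.continuous_cos.neg.max continuous_const))
    calc (∫ θ in (0 : ℝ)..2 * π, -(Real.cos θ * Real.log ‖f (circleMap c R θ)‖))
        ≤ ∫ θ in (0 : ℝ)..2 * π, (M * max (Real.cos θ) 0 + M' * max (-Real.cos θ) 0) :=
          intervalIntegral.integral_mono_on (by linarith [Real.pi_pos]) hi1 hi2 fun θ _ => hpt θ
      _ = 2 * M + 2 * M' := by
          rw [intervalIntegral.integral_add, intervalIntegral.integral_const_mul,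
            intervalIntegral.integral_const_mul, integral_max_cos_zero, integral_max_neg_cos_zero]
          · ring
          · exact (continuous_const.mul (Real.continuous_cos.max continuous_const)).intervalIntegrable _ _
          · exact (continuous_const.mul (Real.continuous_cos.neg.max continuous_const)).intervalIntegrable _ _
  -- (3) combine
  have hint_bound : -(1 / (π * R) * ∫ θ in (0 : ℝ)..2 * π, Real.cos θ * Real.log ‖f (circleMap c R θ)‖) ≤
      2 * (M + M') / (π * R) := by
    rw [← mul_neg, show 2 * (M + M') / (π * R) = 1 / (π * R) * (2 * M + 2 * M') by field_simp]
    exact mul_le_mul_of_nonneg_left hineq (by positivity)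
  linarith

end Literature.Analysis.Complex

end
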